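import Literature.MathematicalPhysics.QuantumFieldTheory.Balaban1983to89.DagBinding

/-!
# `Balaban1983to89.B6Carve46SectCHyp` — [Balaban1984PropagatorsII] Sect. C pp. 238–250 («C. Basic Operators»: the
# two-scale local operators G_□ (2.89)–(2.94), the Faddeev–Popov ∕ gauge algebra (2.95)–(2.119), the tree-gauge
# inequalities (2.120)–(2.128) with LEMMA 2.4, the representation (2.129)–(2.132) with PROPOSITION 2.5, the random-walk
# expansion (2.133)–(2.141) with PROPOSITION 2.6, the bond operators (2.142)–(2.149) with PROPOSITION 2.7, COROLLARY 2.8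
# (2.150)–(2.151), and the unit-lattice covariances (2.152)–(2.157)): P6 CARVING-FAN BLOCK 46 — census of the block
# against the tree (EVERY printed statement of the block has a declaration of record: a CITE-ONLY block) and ONE
# hypothesis bundle `Hyp` of the block's printed THEOREMS BY NAME over the paper's carrier of record `B6.BlockData`,
# keyed to the consumer (`stmt-QuantumFields-20542`, K1⁷: the DAG leaf `DagBinding.Upstream.b6` ∕ `B6BlockParam`)

statement-level skeleton of published theorems with citation tags; proofs where landed; nothing here is a claim about the
Yang–Mills mass gap

T. Bałaban, *Propagators and renormalization transformations for lattice gauge theories. II*, Commun. Math. Phys. **96**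
(1984) 223–250, doi:10.1007/bf01240221 `[Balaban1984PropagatorsII]` (cell paper "B6"; its [3] = [Balaban1983RegularityDecay]
= B4, [4] = [Balaban1984PropagatorsI] = B5; journal page = PDF page + 222).  STATUS: published, refereed.  PDF held:
`paper:balaban1984-cmp96-propagators-rt-ii`; pp. 238–250 [PDF 16–28] read by this seat on the text layer (`p0016.txt` …
`p0028.txt`, locators «`p00NN.txt:Ln`») AND AS IMAGES (renders `run/shared/lean/pub/pub-balaban/b2b-balaban-ref1/pages/
1984-cmp96-propagators-rt-II/…-p025-x2.png`, `-p026-x2.png`, `-p027-x2.png`, 2026-08-28).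

CITATION HEADER (lean-in-tree rule).  Cell `lit-balaban` (HOME `run/shared/lean/pub/lit-balaban/`), P6 CARVING FAN (D-0154
(3b)), RESERVE decade block 46 of `carve/BLOCKS-41-48.md` (lead g31 RULING #10, 2026-08-28T08:15:48Z; claimed by seat `carve-01`
g6, `carve/STATUS.md` 08:28:36Z): «[B6] Sect. C: basic operators (2.86)–(2.157), Lemma 2.4 p.245, Props 2.5–2.7, Cor 2.8
p.249; 39 SKELETON rows (proved 18, proved-existing 14, typed 4, typed-existing 3); 0 unresolved cites, 0 numbered residual
candidates; KEY stmt-QuantumFields-20542 (K1⁷ `StabilityBAtRecordR13SepCoPH`, DAG n05–n13), also-feeds 20544».  Lead's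
ADDENDUM (carve/STATUS.md 08:22:25Z): «a block whose every printed statement is already in tree lands a CITE-ONLY bundle
(`structure …Hyp` over in-tree names + docstring table) and SAYS SO».  THIS IS SUCH A BLOCK.  Filed `--supports
stmt-QuantumFields-20542`.  RULES (`carve/CARVE-RULES.md` §2): IN TREE = CITE, NEVER RESTATE; ONE bundle `Hyp`; no
`instance`, no `notation`, 0 `sorry`; standing-smallness binders displayed (RULING #9): the only one on these pages, «M
sufficiently large» (inherited from Prop. 2.2 through «Reasoning in the same way as in the proof of Proposition 2.2», p. 247,
and (2.134)–(2.135) O(M⁻¹)), is carried INSIDE the cited in-tree bodies as `∃ M₁ > 0, … M₁ ≤ (geo i).M → …`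
(`B6.Prop26Printed`, `B6.Prop27Printed`, `B6.Cor28Printed`); nothing new is bound here.  SEAM with block 45: Proposition 2.3
(2.86)–(2.87) p. 238 is block 45's row B6.Prop2.3 (`B6.Prop23Printed`); this block starts at (2.88) and the heading «C. Basic
Operators» (p. 238, `p0016.txt:L19–L26`).  OFF-LIMITS in-flight stems (BLOCKS-41-48 LEAD NOTE (iv)) `B6*V1L0` ∕ `B6*V1L3` ∕
`B6*KLevel*`, `B9*`, `B5G0*` ∕ `B5Prop12*`, NE-spine: cited by name only.

## WHAT THE BLOCK'S PAGES PRINT AND WHERE THE TREE HOLDS IT (cite table; r03 = the [B6] fold's ledger `HOME/SKELETON.md`;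
## every one of the 39 SKELETON rows of block 46 is IN TREE — nothing in this table is restated below)
* **(2.88)** p. 238 (`p0016.txt:L19–L25`) «Finally let us consider the kernel of the operator ∂P∂* appearing in dRd*, R = I − P
  given by (2.18). We have from Lemma 2.1, Proposition 2.2 and (2.87), |(∂P∂*)_{μν}(x, x′)| ≦ O(1)Σ … ≦ O(1)(L^jη)⁻²(L^{j′}η)^{−d}
  e^{−δ₂d(y,y′)} (2.88) … and δ₂ is determined by δ₀, δ₁» — row B6.Eq2.88 PROVED-existing (implication kind): `B6Cor28.Ineq288`
  (typed shape), `B6Cor28.ineq288_printed_of_lemma21` (from Lemma 2.1 + the factor bounds, with the generic Lemma-2.1 constant).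
* **(2.89)–(2.90)** pp. 238–239 (cubes □̃, □̃², □̃³ = T_□; B^j(Λ) = □̃² ∩ B^{j+1}(Λ_{j+1}) (2.89); G_□ = (Δ − ∂P_□∂* + Q*aQ)⁻¹
  (2.90); G₀ = Σ_□ h_□G_□h_□) — row B6.Eq2.89: `B6.LocalOp` (carrier, `S : B5.Setting`, `Repr2129`), `B6Elimination.BlockClosed`,
  `B6Eq291Generator.gZero`; the cut-offs ζ_□ of p. 239 ll. 18–21: `B6TorusCutoffChi.Core`.
* **(2.91)–(2.93)** p. 239 (Δ_aG₀ = I − Σ K_{□,□′}G_{□′}h_{□′} = I − R) — row B6.Eq2.91: `B6Eq291Generator.eq291` ∕ `kFam` ∕ `rOp`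
  (REPAIRED index of the cut-off in (2.93)) with the AS-PRINTED forms `kOffPrinted` ∕ `kFamPrinted` ∕ `rOpPrinted` kept (r03:
  (2.93) refuted as printed — cut-off indexed by the output cube — and proved repaired; located, cited, not re-typed here).
* **(2.94)** p. 239 (rescaling η ↦ ξ = L^{−j}) — row B6.Eq2.94 PROVED: `B6Eq294Scaling.eq294`.
* **(2.95)–(2.119)** pp. 240–243 (Faddeev–Popov, the gauge transformations λ = H′_jμ (2.98)–(2.104), the translations
  (2.105)–(2.117), ⟨B, Δ_jB⟩ (2.118), the identity (2.119)) — rows B6.Eq2.95 `B6Eq295.eq295_first`; B6.Eq2.98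
  `B6Eq295.eq298_iff_eq299`; B6.Eq2.102 `B6Eq295.hPrime_minimises`, `B6Eq2102Gaussian.eq2102`; B6.Eq2.103 `B6Eq2103.invariant_iff` ∕
  `invariant_of_2104`; B6.Eq2.105 `B6Hprime2101.dP`, `B6Eq2112.integrand_297_eq_2105`; B6.Eq2.108 `B6Hprime2101.dP_ofReal` (the
  printed formula kept literally as `B6Hprime2101.dPrinted`, (2.101) as `hPrinted` ∕ `hP`); B6.Eq2.110 `B6Elimination.site242_uniform`
  (with p. 242 ll. 21–24 «From the theorem on unit lattice operators in [3] it follows that a covariance C^{(j)}_{Λ′} … is a bounded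
  operator with an exponential decay independent of j and Λ» PROVED there and in `B6Cov2110DecayV1.cov_kernel_decay_uniform`; the
  aside p. 242 l. 19 «in fact we may get γ′₀ = π²∕L²» is the fold's located aside of row B6.Eq2.110 — certified order L⁻⁴,
  `B6Ineq2110TwoScaleV1.ineq2110_of_neZero`); B6.Eq2.111 `B6Eq295.eq2111_exponent`, `B6Eq2112Assembly.eq2112`; B6.Eq2.118
  `B5.FormData` ∕ `B5.Bounds167` (= B5 (1.67)), `B6.h2118_of_B5`; B6.Eq2.119 `B6GaussianIdentity2119.eq2119` — all PROVED ∕ bodied.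
  p. 241 ll. 13–15 «H′_j is a bounded operator with an exponential decay, the bound and decay rate depending on d only»:
  `B6SchurTorusBound.norm_le_of_schur`, `B6HprimeOpNormV1.norm_hP_sq_le`, `B6Hprime2132Holder.norm_hP_le_W` (PROVED, model level).
* **(2.120)–(2.128), LEMMA 2.4** pp. 244–245 — rows B6.Eq2.120 `B6AveragingBound.*` (forms (2.120)∕(2.122), condition (2.121) =
  `B6.TreeData.TreeGauge`); B6.Eq2.123 `B6.Step2123` (+ its complete printed derivation); B6.Eq2.124 `B6.sq_sum_third`; B6.Eq2.125
  `B6AveragingBound.ineq2125`; B6.Eq2.127 `B6.Step2127` — the p. 245 layer sentence «This quadratic form is bounded from below by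
  L^{−d−1}Σ|B_μ(x)|²» is REFUTED AS PRINTED for L ≥ 10 (`B6.claim_p245_fails_L10`, `B6.ineq2127_fails_L10`; cell GAPS G-B6-09)
  and PROVED REPAIRED with κ_L = `B6.kappaL` (`B6.Lemma24Repaired`, `lemma24Repaired_of_steps`, G-B6-09R∕10); **Lemma 2.4 (2.128)**
  row B6.Lem2.4: `B6.Lemma24Printed` (verbatim, hypothesis form — IN THE BUNDLE, `Hyp.lem24`), the assembly «(2.123) and (2.127)
  imply many other inequalities. One of them is formulated in Lemma 2.4» KERNEL-CHECKED (`B6.lemma24_assembly_core`,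
  `lemma24K_of_steps`, G-B6-08), and the printed constant 1∕(12d²) PROVED for every L on the concrete carriers by a repaired route
  (`B6Lemma24Printed.lemma24Printed_carrier`, `B6Lemma24Torus.lemma24Printed_torus`; r03: proved-existing).
* **p. 246 ¶1** (`p0024.txt:L2–L10`) «Another consequence is a bound from below for the form (2.120), or for the form (2.122) …
  This implies that a covariance C̃^{(j)}_Λ of the Gaussian integral in (2.119) is bounded from above by a positive constant
  dependent on d and L only, and it has an exponential decay …» — row B6.Txt@246 PROVED: `B6FromB4.UseSite` ∕ `useSites_uniform`,
  `B6BlockDecayHprimeCovV1.cov_entry_uniform` ∕ `blockBound_C_of_entry`; **(2.129)** row B6.Eq2.129 PROVED `B6Repr2129.eq2129`;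
  **(2.130)** «Thus this operator coincides with the operator introduced in Sect. D» row B6.Eq2.130 `B6SectA.hOp`,
  `B6BlockDecayHjCovV1.blockBound_Hj`; **(2.131)** row B6.Eq2.131 `B6SectA.tildeOp`; **(2.132)** row B6.Eq2.132 `B6Hprime2101.hP`;
  p. 246 ll. 18–23 «derivatives of H′_j up to third order, and their local Hölder norms as in (2.67), are uniformly bounded and
  have a uniform exponential decay with a decay rate depending on d only» (GAPS G-B6-06: «the analyticity method described in
  [3]», asserted in print) — PROVED at the model level: `B6BlockDecayHprimeCovV1.abs_dker_re_le` ∕ `blockBound_gradHp` ∕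
  `blockBound_gradLapHp`, `B6BlockDecayGradFactorsV1.blockBound_DgradHp`, `B6BlockDecayGrad2FactorsV1.blockBound_DDgradHp`,
  `B6BlockHolderLipFactorsV1.holderBound_gradHp`.
* **PROPOSITION 2.5** p. 246 (`p0024.txt:L24–L28`) «All the above considerations imply the following Proposition 2.5. The
  operator G_□ defined by (2.90) on the torus T_□ (or on the whole lattice ξZ^d) has the representation (2.129) and satisfies
  all the inequalities (1.110)–(1.114) of the Proposition 1.2 with a positive constant δ₂ instead of δ₀. This constant
  depends on d and L only.» — row B6.Prop2.5: `B6.Prop25Printed` over `B6.LocalOp` ∕ `B5.Ineq110_114` (verbatim, hypothesis form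
  — IN THE BUNDLE, `Hyp.prop25`; edge `B6.prop12Shape_of_prop25`), INHABITED in tree on the genuine carriers:
  `B6Prop25TwoScaleCensus.prop25Printed_TS` (one genuine two-scale step), `B6Prop25OneLevelV1` ∕ `B6LeafB6OneLevelFamG.prop25Printed_knitG`.
  The remark p. 246 l. 29 – p. 247 l. 3 (recursive equations vs. [3] (2.34)) is narrative — no statement.
* **(2.133)–(2.135)** p. 247 — rows B6.Eq2.133 `B6Prop26Gluing.LocalMajorant`, `B6CubeRightLegsV1.ineq2133_GDl`; B6.Eq2.134
  `B6Prop26Gluing.majorant_R_of_2134` (GAPS G-B6-11: support-separation smallness); B6.Eq2.135 `B6Prop26Gluing.ineq2135_of_2134_291`.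
* **PROPOSITION 2.6 (2.136)–(2.141)** p. 247 (`p0025.txt:L13–L38`; render p025) «Reasoning in the same way as in the proof of
  Proposition 2.2 we obtain Proposition 2.6. There exists a positive constant δ₃ depending on d and L only, such that |(GJ)(x)|,
  |(∇GJ)(x)|, |(G∇*J)(x)|, |(ΔGJ)(x)| ≦ O(1)[(L^jη)², L^jη, L^jη, 1]e^{−δ₃d(y,y′)}|J| (2.136) for x ∈ Δ(y), y ∈ Λ_j, supp J ⊂
  Δ(y′), with the constant O(1) depending on d and L only; … (2.137) … (2.138) … (2.139) … (2.140) … The operator G can be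
  represented as G = G₀(I − R)⁻¹ = Σ_{n=0}^∞ G₀Rⁿ = Σ_ω h_{□₀}G_{□₀}h_{□₀}K_{□₁,□₂}G_{□₂}h_{□₂}⋯K_{□_{2n−1},□_{2n}}G_{□_{2n}}h_{□_{2n}},
  (2.141) and the series above is convergent in the norms appearing in the inequalities (2.136)–(2.140).» — row B6.Prop2.6:
  `B6.Prop26Printed` ∕ `B6.Ineq2136_2140` ∕ `B6.GFamily` ∕ `pref4` ∕ `pref6` (verbatim frame — IN THE BUNDLE, `Hyp.prop26`); (2.141)
  and its convergence: `B6Eq2141Expansion.eq2141_tsum` ∕ `series_right_inverse`, `B6.neumann_majorant`; INHABITED HYPOTHESIS-FREE in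
  tree at k levels for the genuine G = Δ_a⁻¹ on the V1 torus family: `B6Prop26PrintedKLevelFinalV1.prop26Printed_kLevel` (r03:
  proved; chain `B6RandomWalk.prop26_chain_2136`, `B6Prop26.prop26_three_entries_of_lemma21`).  p. 248 ll. 1–2 (the symbol
  ‖·‖^ξ_α): notation remark, no statement.
* **p. 248 ll. 4–5** (`p0026.txt:L4–L5`; render p026) «Let us also repeat once more that this theorem holds for the operators G(Ω)
  with Dirichlet boundary conditions on Ω^c, Ω ⊃ Ω₁.» («once more» = p. 228, block 45's range: «All the reasonings and the
  results of this paper hold, with minor and obvious changes, for the operators G(Ω)»; cell GAPS G-B6-02: asserted, not written;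
  C-B6-7) — IN TREE as (i) the quoted warrant of the consumer's dictionary `B9FromB6.DictAtOne` (B9 Cor. 3.5's U = 1 base consumes
  `B6.Prop26Printed` for the family of Ω₀-Dirichlet operators, GAPS G-A1-2) and (ii) the kernel-checked compression principle
  `B6GOmega.hyp56_compress` ∕ `cutFamily_uniform` ∕ `CutFamilyUniform` (the [3]-Sect.-5 families with cut cubes obey the uncut
  constants); as a HYPOTHESIS it is the in-tree predicate `B6.Prop26Printed` instantiated at the family of the operators G(Ω) —
  IN THE BUNDLE BY NAME as the slot `Hyp.prop26Ω` (no new definition).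
* **(2.142)–(2.148)** pp. 248–249 («The operator QGQ* is positive, hence the inverse is well defined and positive also» p. 248
  ll. 7–8: `B6Eq2143TwoScaleV1.QGQs_posDef_V1` ∕ `isUnit_QGQs_V1` ∕ `inverse_QGQs_pos_V1`) — rows B6.Eq2.142 `B6Ineq2142.abs_avgOp_le`,
  `B6Prop27Kernel.*` (PROVED: «From (2.136) we have (2.142)»); B6.Eq2.143 `B6Eq2143TwoScaleV1.QGQs`, `B6FromB4.CubeSite`; B6.Eq2.144
  `B6Eq2144.eq2144` ∕ `eq2145` ∕ `eq2146` ∕ `ineq2147_printed` ∕ `inner_cov_ge` (the gauge-invariance remark p. 248 ll. 21–26: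
  `B6Eq2144.drop_term` ∕ `inv_source`; «‖B₁‖² is bounded from below by const‖B‖²»: `B6AdjointAveraging.p248_lower`,
  `B6Axial2121TwoScaleV1.printed_B1_lower`; (2.147): `B6WeightedEncoding.WSite.Printed`); p. 248 l. 37 – p. 249 l. 2 «Of course we
  have also a similar bound from above and an exponential decay of a kernel of the operator in (2.147). This implies the same
  properties for C^ξ_□ with the corresponding bounds and a decay rate δ₄» and **(2.148)**: row B6.Eq2.148 `B6FromB4.Ineq2148` ∕
  `ineq2148_of_sect5` (GAPS G-B6-12: via [3] Sect. 5), `B6Sect5Closed.ineq2148_weighted` (UNCONDITIONAL),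
  `B6CovTildeDecayV1.kernel2147_decay_uniform`.
* **PROPOSITION 2.7 (2.149)** p. 249 (`p0027.txt:L4–L12`; render p027) «We form the equality for QGQ*C in exactly the same way as
  in (2.82) … (we replace +4 and −4 in (2.83) by +2 and −2), thus we have (2.85) and this implies Proposition 2.7. The operator
  (QGQ*)⁻¹ is given by the convergent expansions of the form (2.86), and it satisfies the bound |(QGQ*)⁻¹(b, b′)| ≦ O(1)(L^jη)⁻²
  (L^{j′}η)^{−d}e^{−½δ₄d(b,b′)}, b ∈ Λ_j, b′ ∈ Λ_{j′}. (2.149)» — row B6.Prop2.7: `B6.Prop27Printed` over `B6.SiteKernel` (verbatim —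
  IN THE BUNDLE, `Hyp.prop27`); BY ITS PRINTED PROOF: `B6Prop27Kernel.inverse_kernel_pow` ∕ `inverse_assembled_pow` ∕
  `prop27Printed_of_assembled`, `B6CoverRealizes.inverse_assembled_pow_box`, `B6TowerPrinted.*`; INHABITED HYPOTHESIS-FREE on the
  genuine families: `B6Prop27PrintedTwoScaleV1.prop27Printed_twoScale`, `B6Prop27PrintedKLevelV1.prop27Printed_kLevel`.
* **COROLLARY 2.8 (2.150)–(2.151)** p. 249 (`p0027.txt:L13–L22`) «We will apply the results obtained until now to many different
  problems. At first let us consider the operator H. We have Corollary 2.8. A kernel of the operator H, (HB)(b) = Σ_{c∈𝔅}(L^{j(c)}η)^d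
  H(b, c)B(c), (2.150) satisfies the inequality |H(b, c)|, |(∇H)(b, c)|, ‖(ζ∇H)(·, c)‖_α ≦ O(1)[1, (L^jη)⁻¹, (L^jη)^{−1−α}(‖ζ‖^ξ_α
  + |ζ|)](L^{j′}η)^{−d}e^{−δ₅d(y,c₋)}, (1.151) ⟦sic: (2.151)⟧ b ∈ Δ(y) or supp ζ ⊂ Δ(y), y ∈ Λ_j, c₋ ∈ Λ_{j′}. This Corollary and
  Proposition 2.6 are our main technical results. They will be used systematically in subsequent papers.» — row B6.Cor2.8:
  `B6.Cor28Printed` over `B6.HFamily` (verbatim — IN THE BUNDLE, `Hyp.cor28`), `B6.MainResults` ∕ `mainResults_of_statedBlock`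
  («main technical results»); the unprinted composition Prop. 2.6 ∘ Prop. 2.7 ⇒ Cor. 2.8 KERNEL-CHECKED: `B6Cor28.Cor28Entry` ∕
  `cor28_scaling_entries`; INHABITED: `B6Cor28OneScaleTorus` (one scale), `B6Cor28HolderUnifKLevelV1.cor28Printed_kLevel` (k levels,
  genuine H = GQ*(QGQ*)⁻¹); consumer at U = 1: `B9FromB6.DictAtOne` (B9 Cor. 3.5).
* **(2.152)–(2.153)** p. 249 (`p0027.txt:L23–L29`) «Next let us consider the inequality (2.128) in Lemma 2.4 again. … Using (2.118)
  and (2.128) we get ⟨B, Δ_kB⟩ ≧ (γ₀∕12d²)L^{−d−1}‖B‖², or Δ_k ≧ (γ₀∕12d²)L^{−d−1} (2.153) on the subspace of B satisfying: QB = 0,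
  B(Γ_{y,x}) = 0 for x ∈ B(y).» (the integral is printed «(1.152)» ⟦sic⟧) — row B6.Eq2.152 PROVED-existing: `B6.LowerBound2153`
  (typed) with `B6.lowerBound2153_of_lemma24` (exactly the printed two-line argument; factor form `LowerBound2153K` ∕
  `lowerBound2153K_of_lemma24K`) — delivered out of the bundle as `Hyp.lowerBound2153` below, no slot.
* **(2.154)–(2.157)** pp. 249–250 (the covariance C^{(k)}_Λ, elimination B = CB′ (2.155)–(2.156), ⟨B′, C*Δ_kCB′⟩ ≧ γ′₀‖B′‖² (2.157),
  and p. 250 ll. 10–13 «C is a short-ranged operator, so C*Δ_kC has the same exponential decay as Δ_k. Now we may apply the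
  theory developed in Sect. 5 of [3] on unit lattice operators. It gives us an exponential decay, and all the other properties,
  for the operator (C*Δ_kC)⁻¹, hence for C^{(k)}_Λ also.») — rows B6.Eq2.154 `B6BondElimination.SubReduction` (∕ `.Printed`),
  `B6BondEliminationTorus.FrameSubReduction.Printed` ∕ `PrintedPer`; B6.Eq2.157 `B6.bound2157`; the [3]-step KERNEL-CHECKED:
  `B6BondEliminationTorus.subReductions_per`, `B6FrameReduction.Reduction.Printed` ∕ `B6FromB4.Reduction.Printed` (the S-sites of
  [3] Sect. 5 in this paper).  p. 250 ll. 14–15 («Such a scheme will be applied in the future …») and the reference list: no statement.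

RESULT OF THE CENSUS.  Every printed statement of pp. 238–250 — the five theorems (Lemma 2.4, Props. 2.5, 2.6, 2.7, Cor. 2.8),
every numbered display (2.88)–(2.157), and every unnumbered claim sentence (p. 241 ll. 13–15, p. 242 ll. 17–24, p. 246 ¶1 and
ll. 16–23, p. 248 ll. 4–5, 7–8, 21–26, 33–37, p. 248 l. 37 – p. 249 l. 2, p. 250 ll. 7–13) — has a declaration of record (most
of them PROVED, several refuted-as-printed-and-repaired by the [B6] fold: (2.93), the p. 245 layer claim ∕ (2.127), the p. 242
aside); the block's residual is EMPTY; this file types NO new `…Printed` statement and NO new carrier vocabulary (the bundle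
is over `B6.BlockData`, the paper's carrier record, plus a second `B6.Geometry`∕`B6.GFamily` family for the G(Ω) sentence).
Residual ROW candidates for the [B6] fold (r03, PARKED; lead = fold owner of last resort): NONE.

## WHAT THIS FILE ADDS
§1 `Carriers` = the paper's `B6.BlockData` (index families and functionals of Lemma 2.1 – Cor. 2.8, from `B6.lean`) + the family
of the operators G(Ω) of p. 248 seen through the same functionals; the bundle `structure Hyp (X : Carriers) : Prop` = the
block's hypothesis-form printed THEOREMS BY NAME: `lem24` (`B6.Lemma24Printed`), `prop25` (`B6.Prop25Printed`), `prop26`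
(`B6.Prop26Printed`), `prop26Ω` (`B6.Prop26Printed` at the G(Ω) family — p. 248 ll. 4–5), `prop27` (`B6.Prop27Printed`), `cor28`
(`B6.Cor28Printed`) — i.e. exactly the Sect.-C conjuncts of the DAG leaf's Prop `B6.StatedBlock` ∕ `DagBinding.B6BlockRest` plus the
G(Ω) sentence; the displays (2.88)–(2.157) are PROVED ∕ bodied in tree (table) and take no slot.
§2 KERNEL-CHECKED BOOKKEEPING out of `Hyp` (no statement asserted): `Hyp.mainResults` (p. 249 «our main technical results» =
`B6.MainResults`); ★ `Hyp.statedBlock` ∕ ★ `Hyp.b6BlockRest` ∕ ★ `Hyp.b6BlockParam` (with block 45's Lemma 2.1 ∕ Prop. 2.2 ∕ Prop. 2.3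
the bundle IS the DAG leaf `B6.StatedBlock` = `DagBinding.Upstream.ofPrinted….b6`, resp. `DagBinding.B6BlockRest`, resp. the
parameter-form leaf `DagBinding.B6BlockParam` that `Upstream.ofPrintedAllXP` binds); ★ `dag_b6` (the field `b6` of
`DagBinding.Upstream.ofPrinted P …` itself); `Hyp.lemma24K` (Lemma 2.4 ⇒ every Lemma 2.4_κ, κ ≤ 1 — the repaired lemma costs
nothing downstream, `B6.lemma24K_mono`); `Hyp.lowerBound2153` ((2.153) from (2.128) + (2.118) exactly as printed,
`B6.lowerBound2153_of_lemma24`); `Hyp.prop12Shape` (Prop. 2.5 ⇒ B5 Prop. 1.2's predicate for the local operators,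
`B6.prop12Shape_of_prop25`); `hyp_of_b6BlockRest` (five of the six slots from the DAG leaf's Prop).  §3 non-vacuity `hyp_empty`
(empty index families: the slots are jointly satisfiable as typed; their GENUINE inhabitation in tree is cited in the table).

## HONEST SCOPE
Nothing of [Balaban1984PropagatorsII] is proved here beyond bookkeeping between typed shapes and the cited theorems; every slot
is a HYPOTHESIS on abstract carriers (inhabited by empty families, `hyp_empty`; inhabited GENUINELY only by the cited V1-torus
theorems, which this file does not import); Lemma 2.4's slot is the PRINTED statement (constant 1∕(12d²)), whose printed ROUTE is
refuted at (2.127) for L ≥ 10 and which is proved in tree by a repaired route on the concrete carriers — recorded, not re-adjudicated;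
the G(Ω) slot records an ASSERTED sentence (GAPS G-B6-02) as a hypothesis, nothing more.  No summit statement is proved by this
seat; K1⁷ ∕ the DAG leaf `b6` is NOT discharged here (its model-level inhabitation is the cited `B6LeafB6OneLevelFamG.leaf_b6_knitG` ∕
`DagBinding.B6BlockParam` lineage); count-neutral; nothing continuum ∕ ℝ⁴ ∕ OS ∕ mass-gap ∕ Clay.  No `sorry`, no `instance`, no
`notation`, no attribute manipulation; imports `…DagBinding` only (hence `…B6`, `…B5`, `…B6Lemma21Repaired`, `…B6RandomWalk`).
-/

namespace Literature.MathematicalPhysics.QuantumFieldTheory.Balaban1983to89.B6Carve46SectCHyp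

/-! ## §1  The bundle: the printed theorems of Sect. C as hypotheses, by name, on the paper's carriers -/

/-- **Carriers of the block-46 bundle** (plain data): `D : B6.BlockData` — the paper's carrier record of `B6.lean` (index
families of multiscale geometries (2.1)–(2.2) with the operators G′, (Q′G′²Q′*)⁻¹, G, (QGQ*)⁻¹, H seen through their printed
functionals, the unit-lattice tree-gauge data of Lemma 2.4, the local operators G_□ of Prop. 2.5; d, L, δ₀); and, for the
sentence p. 248 ll. 4–5, a second family `geoΩ`∕`GΩ` indexed by `IΩ` = (geometry, Ω ⊃ Ω₁): the operators G(Ω) = (ΩΔ_aΩ)⁻¹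
with Dirichlet boundary conditions on Ω^c (p. 228) seen through the same functionals `B6.GFamily` of (2.136)–(2.140).
[cite: Balaban1984PropagatorsII, pp.238–250; p.228 + p.248 (G(Ω))] -/
structure Carriers where
  D : B6.BlockData
  IΩ : Type
  geoΩ : IΩ → B6.Geometry
  GΩ : ∀ i, B6.GFamily (geoΩ i)

/-- **BLOCK 46 OF [B6] AS ONE HYPOTHESIS BUNDLE** (Sect. C pp. 238–250 [PDF 16–28]): the block's printed theorems, each the
VERBATIM in-tree predicate BY NAME over the paper's carriers —
`lem24` = **Lemma 2.4** p. 245 «Let a set Λ ⊂ Z^d be a sum of blocks, Λ = B(Λ′). … Let B be a configuration defined on Λ and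
satisfying the condition (2.121) … Then the following inequality holds L^{d−2}Σ_{c∈Λ′}|(Q₁B)(c)|² + Σ_p|(∂₁B)(p)|² ≧ (1∕(12d²))
L^{−d−1}‖B‖². (2.128)» (`B6.Lemma24Printed`);
`prop25` = **Proposition 2.5** p. 246 «The operator G_□ defined by (2.90) on the torus T_□ (or on the whole lattice ξZ^d) has the
representation (2.129) and satisfies all the inequalities (1.110)–(1.114) of the Proposition 1.2 with a positive constant δ₂
instead of δ₀. This constant depends on d and L only.» (`B6.Prop25Printed`);
`prop26` = **Proposition 2.6** p. 247 «There exists a positive constant δ₃ depending on d and L only, such that (2.136)–(2.140)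
…» (`B6.Prop26Printed`; the «M sufficiently large» binder of its printed proof «as in the proof of Proposition 2.2» is inside
the predicate);
`prop26Ω` = **p. 248 ll. 4–5** «Let us also repeat once more that this theorem holds for the operators G(Ω) with Dirichlet
boundary conditions on Ω^c, Ω ⊃ Ω₁.» — the same predicate at the family of the operators G(Ω) (cell GAPS G-B6-02: asserted
in print; consumer `B9FromB6.DictAtOne`);
`prop27` = **Proposition 2.7** p. 249 «The operator (QGQ*)⁻¹ is given by the convergent expansions of the form (2.86), and it
satisfies the bound |(QGQ*)⁻¹(b, b′)| ≦ O(1)(L^jη)⁻²(L^{j′}η)^{−d}e^{−½δ₄d(b,b′)}, b ∈ Λ_j, b′ ∈ Λ_{j′}. (2.149)» (`B6.Prop27Printed`);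
`cor28` = **Corollary 2.8** p. 249 «A kernel of the operator H, (HB)(b) = Σ_{c∈𝔅}(L^{j(c)}η)^d H(b, c)B(c), (2.150) satisfies the
inequality |H(b, c)|, |(∇H)(b, c)|, ‖(ζ∇H)(·, c)‖_α ≦ O(1)[1, (L^jη)⁻¹, (L^jη)^{−1−α}(‖ζ‖^ξ_α + |ζ|)](L^{j′}η)^{−d}e^{−δ₅d(y,c₋)},
(1.151) ⟦sic⟧ b ∈ Δ(y) or supp ζ ⊂ Δ(y), y ∈ Λ_j, c₋ ∈ Λ_{j′}.» (`B6.Cor28Printed`).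
The displays (2.88)–(2.157) and the unnumbered claims of pp. 238–250 are PROVED ∕ bodied in tree (module docstring's table) and
take no slot; Lemma 2.1 ∕ Props. 2.2–2.3 are block 45's and enter §2 as explicit hypotheses.  Hypothesis slots only; nothing
asserted; GENUINE inhabitation of every slot except `prop26Ω` is in tree (table). [cite: Balaban1984PropagatorsII, Lemma 2.4 p.245, Prop. 2.5 p.246, Prop. 2.6 p.247, p.248 ll.4–5, Prop. 2.7 p.249, Cor. 2.8 p.249] -/
structure Hyp (X : Carriers) : Prop where
  /-- Lemma 2.4 (2.128) p. 245 — in tree: `B6.Lemma24Printed`. -/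
  lem24 : B6.Lemma24Printed X.D.d X.D.L X.D.tree
  /-- Proposition 2.5 p. 246 — in tree: `B6.Prop25Printed`. -/
  prop25 : B6.Prop25Printed X.D.loc
  /-- Proposition 2.6 (2.136)–(2.141) p. 247 — in tree: `B6.Prop26Printed`. -/
  prop26 : B6.Prop26Printed X.D.geo X.D.G
  /-- p. 248 ll. 4–5: Proposition 2.6 for the operators G(Ω), Dirichlet conditions on Ω^c, Ω ⊃ Ω₁ — in tree: `B6.Prop26Printed`. -/
  prop26Ω : B6.Prop26Printed X.geoΩ X.GΩ
  /-- Proposition 2.7 (2.149) p. 249 — in tree: `B6.Prop27Printed`. -/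
  prop27 : B6.Prop27Printed X.D.d X.D.geo X.D.Qinv
  /-- Corollary 2.8 (2.150)–(2.151) p. 249 — in tree: `B6.Cor28Printed`. -/
  cor28 : B6.Cor28Printed X.D.d X.D.geo X.D.H

/-! ## §2  Bookkeeping (kernel-checked uses of the cited declarations; no statement asserted) -/

section Bookkeeping

variable {X : Carriers}

/-- **p. 249** «This Corollary and Proposition 2.6 are our main technical results. They will be used systematically in subsequent
papers.» — the bundle contains `B6.MainResults` (Prop. 2.6 ∧ Cor. 2.8), the sub-block B9 Cor. 3.5 imports at U = 1.  Bookkeeping.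
[cite: Balaban1984PropagatorsII, p.249 (bookkeeping)] -/
theorem Hyp.mainResults (hX : Hyp X) : B6.MainResults X.D := ⟨hX.prop26, hX.cor28⟩

/-- ★ With block 45's Proposition 2.2 and Proposition 2.3 the bundle gives `DagBinding.B6BlockRest` (the stated block of the
paper WITHOUT its Lemma 2.1 conjunct: Props. 2.2, 2.3, Lemma 2.4, Props. 2.5, 2.6, 2.7, Cor. 2.8) — by name.  Bookkeeping.
[cite: Balaban1984PropagatorsII, pp.234–249 (bookkeeping)] -/
theorem Hyp.b6BlockRest (hX : Hyp X) (h22 : B6.Prop22Printed X.D.geo X.D.Gp)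
    (h23 : B6.Prop23Printed X.D.d X.D.geo X.D.Cinv) : DagBinding.B6BlockRest X.D :=
  ⟨h22, h23, hX.lem24, hX.prop25, hX.prop26, hX.prop27, hX.cor28⟩

/-- ★ **The consumer's letter, printed form**: with block 45's Lemma 2.1, Prop. 2.2, Prop. 2.3 the bundle IS the paper's stated
block `B6.StatedBlock X.D` — the Prop bound to the DAG leaf `b6` by `DagBinding.Upstream.ofPrinted` (node N03 `Dag.B6_main`,
K1⁷'s n05–n13 cone).  Bookkeeping; the leaf is NOT discharged here. [cite: Balaban1984PropagatorsII, pp.223–250 (bookkeeping)] -/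
theorem Hyp.statedBlock (hX : Hyp X) (h21 : B6.Lemma21Printed X.D.d X.D.δ₀ X.D.geo)
    (h22 : B6.Prop22Printed X.D.geo X.D.Gp) (h23 : B6.Prop23Printed X.D.d X.D.geo X.D.Cinv) : B6.StatedBlock X.D :=
  ⟨h21, h22, h23, hX.lem24, hX.prop25, hX.prop26, hX.prop27, hX.cor28⟩

/-- ★ **The consumer's letter, parameter form**: with Lemma 2.1 in the PARAMETER form `DagBinding.B6Lemma21Param` (∃ c₁(α) — the
form the cell record supports, GAPS G-ref1-11 ∕ G-A12-1) and Props. 2.2–2.3, the bundle gives `DagBinding.B6BlockParam X.D`, the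
`b6` leaf of `DagBinding.Upstream.ofPrintedAllXP`.  Bookkeeping. [cite: Balaban1984PropagatorsII, pp.223–250 (bookkeeping)] -/
theorem Hyp.b6BlockParam (hX : Hyp X) (h21 : DagBinding.B6Lemma21Param X.D)
    (h22 : B6.Prop22Printed X.D.geo X.D.Gp) (h23 : B6.Prop23Printed X.D.d X.D.geo X.D.Cinv) :
    DagBinding.B6BlockParam X.D :=
  ⟨h21, hX.b6BlockRest h22 h23⟩

/-- ★ The field `b6` of the upstream binding `DagBinding.Upstream.ofPrinted P b9 b11 rOp rBS` (= `B6.StatedBlock P.D6` by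
definition) out of the bundle on `P.D6` and block 45's three statements.  Bookkeeping. [cite: Balaban1984PropagatorsII, pp.223–250 (bookkeeping)] -/
theorem dag_b6 (P : DagBinding.PrintedCarriers) {IΩ : Type} {geoΩ : IΩ → B6.Geometry}
    {GΩ : ∀ i, B6.GFamily (geoΩ i)} (hX : Hyp ⟨P.D6, IΩ, geoΩ, GΩ⟩)
    (h21 : B6.Lemma21Printed P.D6.d P.D6.δ₀ P.D6.geo) (h22 : B6.Prop22Printed P.D6.geo P.D6.Gp)
    (h23 : B6.Prop23Printed P.D6.d P.D6.geo P.D6.Cinv) (b9 b11 rOp rBS : Prop) :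
    (DagBinding.Upstream.ofPrinted P b9 b11 rOp rBS).b6 :=
  hX.statedBlock h21 h22 h23

/-- **Lemma 2.4 ⇒ Lemma 2.4_κ for every κ ≤ 1** (‖B‖² ≥ 0, L > 0; `B6.lemma24K_mono`): in particular the REPAIRED lemma (κ = κ_L,
`B6.kappaL`, cell GAPS G-B6-10) is implied by the printed slot — replacing the printed Lemma 2.4 by the repaired one costs
nothing downstream.  Bookkeeping. [cite: Balaban1984PropagatorsII, Lemma 2.4 (2.128) p.245 (bookkeeping)] -/
theorem Hyp.lemma24K (hX : Hyp X) (hL : 0 < X.D.L) {κ : ℝ} (hκ : κ ≤ 1)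
    (hN : ∀ j B, 0 ≤ (X.D.tree j).normSq B) : B6.Lemma24K X.D.d X.D.L κ X.D.tree :=
  B6.lemma24K_mono X.D.d X.D.L 1 κ hL hκ X.D.tree hN ((B6.lemma24K_one_iff X.D.d X.D.L X.D.tree).mpr hX.lem24)

/-- **(2.153) p. 249** «Using (2.118) and (2.128) we get ⟨B, Δ_kB⟩ ≧ (γ₀∕12d²)L^{−d−1}‖B‖², or Δ_k ≧ (γ₀∕12d²)L^{−d−1} (2.153) on the
subspace of B satisfying: QB = 0, B(Γ_{y,x}) = 0 for x ∈ B(y).» — out of the slot `lem24` by the printed two-line argument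
(`B6.lowerBound2153_of_lemma24`): given the forms ⟨B, Δ_kB⟩ with (2.118) (γ₀‖∂₁B‖² ≤ ⟨B, Δ_kB⟩, = B5 (1.67); cf. `B6.h2118_of_B5`)
and the constraint QB = 0 killing the Q₁-term.  Bookkeeping. [cite: Balaban1984PropagatorsII, (2.153) p.249 (bookkeeping)] -/
theorem Hyp.lowerBound2153 (hX : Hyp X) {γ₀ : ℝ} (hγ : 0 ≤ γ₀)
    (formΔk : ∀ j, (X.D.tree j).Cfg → ℝ) (QZero : ∀ j, (X.D.tree j).Cfg → Prop)
    (hQ : ∀ j B, QZero j B → (X.D.tree j).q1Sq B = 0)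
    (h2118 : ∀ j B, γ₀ * (X.D.tree j).d1Sq B ≤ formΔk j B) :
    B6.LowerBound2153 X.D.d X.D.L γ₀ X.D.tree formΔk QZero :=
  B6.lowerBound2153_of_lemma24 X.D.d X.D.L γ₀ hγ X.D.tree formΔk QZero hX.lem24 hQ h2118

/-- **Proposition 2.5 ⇒ B5's Proposition 1.2 predicate** for the family of local operators G_□ (δ₀ ↦ δ₂) — the DAG edge B5 → B6
at the type level (`B6.prop12Shape_of_prop25`).  Bookkeeping. [cite: Balaban1984PropagatorsII, Prop. 2.5 p.246 (bookkeeping)] -/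
theorem Hyp.prop12Shape (hX : Hyp X) : B5.Prop12Printed (fun i => (X.D.loc i).S) :=
  B6.prop12Shape_of_prop25 X.D.loc hX.prop25

/-- Conversely, five of the six slots ARE conjuncts of the DAG leaf's Prop: `DagBinding.B6BlockRest D` (a fortiori
`B6.StatedBlock D`, `DagBinding.statedBlock_iff_lemma21_and_rest`) together with the G(Ω) sentence gives the bundle.
Bookkeeping. [cite: Balaban1984PropagatorsII, pp.234–249 (bookkeeping)] -/
theorem hyp_of_b6BlockRest {D : B6.BlockData} (h : DagBinding.B6BlockRest D) {IΩ : Type}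
    {geoΩ : IΩ → B6.Geometry} {GΩ : ∀ i, B6.GFamily (geoΩ i)} (hΩ : B6.Prop26Printed geoΩ GΩ) :
    Hyp ⟨D, IΩ, geoΩ, GΩ⟩ :=
  ⟨h.2.2.1, h.2.2.2.1, h.2.2.2.2.1, hΩ, h.2.2.2.2.2.1, h.2.2.2.2.2.2⟩

end Bookkeeping

/-! ## §3  Non-vacuity: the bundle is inhabited (empty index families) -/

section Witness

/-- The paper's carrier record with EMPTY index families (no geometry, no tree datum, no local operator). [folklore] -/
def emptyBlockData (d : ℕ) (L δ₀ : ℝ) : B6.BlockData where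
  I := Empty
  d := d
  L := L
  δ₀ := δ₀
  geo := fun i => nomatch i
  Gp := fun i => nomatch i
  Cinv := fun i => nomatch i
  G := fun i => nomatch i
  Qinv := fun i => nomatch i
  H := fun i => nomatch i
  J := Empty
  tree := fun j => nomatch j
  K := Empty
  loc := fun k => nomatch k

/-- Empty carriers: `emptyBlockData` and the empty G(Ω) family. [folklore] -/
def emptyCarriers (d : ℕ) (L δ₀ : ℝ) : Carriers where
  D := emptyBlockData d L δ₀
  IΩ := Empty
  geoΩ := fun i => nomatch i
  GΩ := fun i => nomatch i

/-- **The block-46 bundle is inhabited**: over empty index families every slot holds with the constants M₁ = δ = C = 1 (the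
universal clauses are vacuous) — a NON-VACUITY INSTANCE of the typed bundle (consistency of the typing, nothing about gauge
theories; the GENUINE inhabitation of the slots is the cited `B6Lemma24Torus.lemma24Printed_torus`,
`B6Prop25TwoScaleCensus.prop25Printed_TS`, `B6Prop26PrintedKLevelFinalV1.prop26Printed_kLevel`,
`B6Prop27PrintedKLevelV1.prop27Printed_kLevel`, `B6Cor28HolderUnifKLevelV1.cor28Printed_kLevel`, not imported here).
[cite: Balaban1984PropagatorsII, Lemma 2.4 – Cor. 2.8 pp.245–249 (non-vacuity instance)] -/
theorem hyp_empty (d : ℕ) (L δ₀ : ℝ) : Hyp (emptyCarriers d L δ₀) where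
  lem24 := fun i => nomatch i
  prop25 := ⟨(fun i => nomatch i), 1, 1, fun _ => 0, fun _ => 0, fun _ _ => 0, one_pos, one_pos, fun i => nomatch i⟩
  prop26 := ⟨1, 1, 1, fun _ => 0, fun _ => 0, fun _ _ => 0, one_pos, one_pos, one_pos, fun i => nomatch i⟩
  prop26Ω := ⟨1, 1, 1, fun _ => 0, fun _ => 0, fun _ _ => 0, one_pos, one_pos, one_pos, fun i => nomatch i⟩
  prop27 := ⟨1, 1, 1, one_pos, one_pos, one_pos, fun i => nomatch i⟩
  cor28 := ⟨1, 1, 1, fun _ => 0, one_pos, one_pos, one_pos, fun i => nomatch i⟩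

end Witness

end Literature.MathematicalPhysics.QuantumFieldTheory.Balaban1983to89.B6Carve46SectCHyp
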